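import Summits.ValiantsHypothesis.ValiantsHypothesis.Theorems.DivisionGapZeroOneTransferStubFormulaGridProjectionAux8
import Summits.ValiantsHypothesis.ValiantsHypothesis.Theorems.DivisionGapZeroOneTransferStubFormulaGridProjectionAux5

/-!
# Crux `DivisionGap.ZeroOneTransfer` (stmt-ValiantsHypothesis-5066), line `planar-dimer-sign-elimination` —
stub `stub_formulaGridProjection`, support file 9

support file 9: the parallel layout, part 3 — fillers, the parallel grid gadget, and the
closure properties of "having grid gadgets"

* `par_fillers` — the cells of the big rectangle outside gadgets, wires and frame are exactly four
  thin rectangles, tiled by the dominoes `parTau` (file 6), and no non-zero dart of `parW` starts or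
  ends there; `gad_par` — hence (`gad_fill'`, file 4) the PARALLEL GRID GADGET: a grid gadget for
  `x * gF + y * gG` on the `(hF+hG+2) × (m+2)` rectangle.
* `HasGad⟦ι, R, g, n⟧` (local notation): `g` has grid gadgets of even height and width `≤ n` at
  every position; closed under labels (`hasGad_leaf`, size `2`), products (`hasGad_mul`, series,
  sizes add), label combinations (`hasGad_lin`, parallel after padding to a common width, sizes add
  `+ 2`) and scaling (`hasGad_smul`).

Registered sub-goal proved here: `stub_formulaGridProjection_parallelGadget` (`gad_par` with the
notation expanded). [folklore]
-/

set_option linter.dupNamespace false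

namespace Summit.ValiantsHypothesis.ValiantsHypothesis.Theorems.DivisionGapZeroOneTransfer

namespace FormulaGridProjection

open Finset MvPolynomial

/-- `TwoState⟦D, W, p, q, g⟧` (a LOCAL NOTATION, deliberately not a definition): a TWO-STATE GADGET on the
vertex set `D` with ports `p ≠ q` computing `g` — the whole of `D` has matching sum `g` ("active": both
ports matched inside), `D ∖ {p, q}` has matching sum `1` ("inactive"), and `|D|` is even (so the two
mixed states have matching sum `0` by parity).  The two-attachment case of a gadget signature
(Valiant 1979 §2; DKLM 2010 §4.4). -/
local notation3 "TwoState⟦" D ", " W ", " p ", " q ", " g "⟧" =>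
  p ∈ D ∧ q ∈ D ∧ p ≠ q ∧ Even (Finset.card D) ∧ msum D W = g ∧
    msum (Finset.erase (Finset.erase D p) q) W = 1


/-- `IsLab⟦x⟧` (local notation): `x` is literally a variable `X j` or a constant `C c` — the entries
allowed in a Valiant projection (`IsProjection`). -/
local notation3 "IsLab⟦" x "⟧" => (∃ j, x = MvPolynomial.X j) ∨ ∃ c, x = MvPolynomial.C c

/-- `Adj⟦a, b⟧` (local notation): adjacency of the square grid on `ℕ × ℕ`, verbatim the four disjuncts
of the route's grid-dimer polynomial. -/
local notation3 "Adj⟦" a ", " b "⟧" =>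
  (Prod.fst a + 1 = Prod.fst b ∧ Prod.snd a = Prod.snd b) ∨
    (Prod.fst b + 1 = Prod.fst a ∧ Prod.snd a = Prod.snd b) ∨
    (Prod.fst a = Prod.fst b ∧ Prod.snd a + 1 = Prod.snd b) ∨
    (Prod.fst a = Prod.fst b ∧ Prod.snd b + 1 = Prod.snd a)

/-- `box⟦r, c, h, w⟧` (local notation): the `h × w` rectangle of cells with top-left cell `(r, c)`
(rows `r ≤ i < r + h`, columns `c ≤ j < c + w`). -/
local notation3 "box⟦" r ", " c ", " h ", " w "⟧" =>
  (Finset.Ico r (r + h) ×ˢ Finset.Ico c (c + w) : Finset (ℕ × ℕ))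

/-- `Gad⟦W, r, c, h, w, g⟧` (local notation): `W` is a GRID GADGET for `g` on the rectangle
`box⟦r, c, h, w⟧` — every dart weight is a label, non-zero weights only on darts between adjacent
cells of the rectangle, and the rectangle is a two-state gadget computing `g` with ports its
top-left and top-right cells. -/
local notation3 "Gad⟦" W ", " r ", " c ", " h ", " w ", " g "⟧" =>
  (∀ a b, IsLab⟦W a b⟧) ∧ (∀ a b, W a b ≠ 0 → a ∈ box⟦r, c, h, w⟧ ∧ b ∈ box⟦r, c, h, w⟧ ∧ Adj⟦a, b⟧) ∧
    TwoState⟦box⟦r, c, h, w⟧, W, (r, c), (r, c + w - 1), g⟧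

section ParFill

variable {R : Type*} [CommSemiring R] {ι : Type*}

set_option maxHeartbeats 800000 in
-- the domino tiling is checked cell class by cell class by `omega`
/-- The filler region of the parallel layout (the big rectangle minus gadgets, wires and frame) is
tiled by `parTau`, and no non-zero dart of `parW` starts or ends there. [folklore] -/
theorem par_fillers {WF WG : ℕ × ℕ → ℕ × ℕ → MvPolynomial ι R} {r c hF hG m : ℕ}
    {gF gG x y : MvPolynomial ι R} (hGF : Gad⟦WF, r + 1, c + 1, hF, m, gF⟧)
    (hGG : Gad⟦WG, r + 1 + hF, c + 1, hG, m, gG⟧)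
    (ehF : Even hF) (ehG : Even hG) (em : Even m) (h2F : 2 ≤ hF) (h2G : 2 ≤ hG) (h2m : 2 ≤ m) :
    (∀ a b, a ∈ box⟦r, c, hF + hG + 2, m + 2⟧ \ (box⟦r + 1, c + 1, hF, m⟧ ∪
      ((((box⟦r + 2, c, hF, 1⟧ ∪ box⟦r + 1 + hF, c + 1, hG, m⟧) ∪ box⟦r + 2, c + m + 1, hF, 1⟧)) ∪
        {(r, c), (r, c + m + 1), (r, c + 1), (r + 1, c), (r, c + m), (r + 1, c + m + 1)})) ∨
      b ∈ box⟦r, c, hF + hG + 2, m + 2⟧ \ (box⟦r + 1, c + 1, hF, m⟧ ∪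
      ((((box⟦r + 2, c, hF, 1⟧ ∪ box⟦r + 1 + hF, c + 1, hG, m⟧) ∪ box⟦r + 2, c + m + 1, hF, 1⟧)) ∪
        {(r, c), (r, c + m + 1), (r, c + 1), (r + 1, c), (r, c + m), (r + 1, c + m + 1)})) →
      parW WF WG r c hF m x y a b = 0) ∧
    (∀ a ∈ box⟦r, c, hF + hG + 2, m + 2⟧ \ (box⟦r + 1, c + 1, hF, m⟧ ∪
      ((((box⟦r + 2, c, hF, 1⟧ ∪ box⟦r + 1 + hF, c + 1, hG, m⟧) ∪ box⟦r + 2, c + m + 1, hF, 1⟧)) ∪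
        {(r, c), (r, c + m + 1), (r, c + 1), (r + 1, c), (r, c + m), (r + 1, c + m + 1)})),
      parTau r c hF hG m a ∈ box⟦r, c, hF + hG + 2, m + 2⟧ \ (box⟦r + 1, c + 1, hF, m⟧ ∪
      ((((box⟦r + 2, c, hF, 1⟧ ∪ box⟦r + 1 + hF, c + 1, hG, m⟧) ∪ box⟦r + 2, c + m + 1, hF, 1⟧)) ∪
        {(r, c), (r, c + m + 1), (r, c + 1), (r + 1, c), (r, c + m), (r + 1, c + m + 1)})) ∧
      parTau r c hF hG m a ≠ a ∧ parTau r c hF hG m (parTau r c hF hG m a) = a ∧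
      Adj⟦a, parTau r c hF hG m a⟧) := by
  obtain ⟨hlabF, hsuppF, hTF⟩ := hGF
  obtain ⟨hlabG, hsuppG, hTG⟩ := hGG
  obtain ⟨kF, hkF⟩ := ehF
  obtain ⟨kG, hkG⟩ := ehG
  obtain ⟨km, hkm⟩ := em
  obtain ⟨hXS, hXF, hXG, zF, zG, zX, X1, X2, X3, X4, X5, X6, X7, X8, X9, X10, hWside⟩ :=
    par_prelims (x := x) (y := y) (hG := hG) hsuppF hsuppG h2F h2m
  set X := parX r c hF m x y with hXd
  set W := parW WF WG r c hF m x y with hWd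
  have hX : ∀ u v, X u v =
      if u.1 = r ∧ u.2 = c ∧ v.1 = r ∧ v.2 = c + 1 then x else
      if u.1 = r ∧ u.2 = c ∧ v.1 = r + 1 ∧ v.2 = c then y else
      if ((u.1 = r ∧ u.2 = c + 1 ∧ v.1 = r ∧ v.2 = c) ∨
        (u.1 = r + 1 ∧ u.2 = c ∧ v.1 = r ∧ v.2 = c) ∨
        (u.1 = r ∧ v.1 = r ∧ ((u.2 = c + m + 1 ∧ v.2 = c + m) ∨ (u.2 = c + m ∧ v.2 = c + m + 1))) ∨
        (u.2 = c + m + 1 ∧ v.2 = c + m + 1 ∧ ((u.1 = r ∧ v.1 = r + 1) ∨ (u.1 = r + 1 ∧ v.1 = r))) ∨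
        (u.2 = c + 1 ∧ v.2 = c + 1 ∧ ((u.1 = r ∧ v.1 = r + 1) ∨ (u.1 = r + 1 ∧ v.1 = r))) ∨
        (u.2 = c + m ∧ v.2 = c + m ∧ ((u.1 = r ∧ v.1 = r + 1) ∨ (u.1 = r + 1 ∧ v.1 = r))) ∨
        (u.2 = c ∧ v.2 = c ∧ r + 1 ≤ u.1 ∧ r + 1 ≤ v.1 ∧ u.1 ≤ r + 1 + hF ∧ v.1 ≤ r + 1 + hF ∧
          (u.1 + 1 = v.1 ∨ v.1 + 1 = u.1)) ∨
        (u.2 = c + m + 1 ∧ v.2 = c + m + 1 ∧ r + 1 ≤ u.1 ∧ r + 1 ≤ v.1 ∧ u.1 ≤ r + 1 + hF ∧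
          v.1 ≤ r + 1 + hF ∧ (u.1 + 1 = v.1 ∨ v.1 + 1 = u.1)) ∨
        (u.1 = r + 1 + hF ∧ v.1 = r + 1 + hF ∧
          ((u.2 = c ∧ v.2 = c + 1) ∨ (u.2 = c + 1 ∧ v.2 = c))) ∨
        (u.1 = r + 1 + hF ∧ v.1 = r + 1 + hF ∧
          ((u.2 = c + m + 1 ∧ v.2 = c + m) ∨ (u.2 = c + m ∧ v.2 = c + m + 1)))) then 1 else 0 := fun u v => by rw [hXd]; exact parX_apply r c hF m x y u v
  have hW : ∀ u v, W u v = WF u v + WG u v + X u v := fun u v => rfl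
  -- the filler region: the cells of the rectangle outside the gadgets, the wires and the frame
  have hP : ∀ a ∈ box⟦r, c, hF + hG + 2, m + 2⟧ \ (box⟦r + 1, c + 1, hF, m⟧ ∪
      ((((box⟦r + 2, c, hF, 1⟧ ∪ box⟦r + 1 + hF, c + 1, hG, m⟧) ∪ box⟦r + 2, c + m + 1, hF, 1⟧)) ∪
        {(r, c), (r, c + m + 1), (r, c + 1), (r + 1, c), (r, c + m), (r + 1, c + m + 1)})),
      a ∈ box⟦r, c + 2, 1, m - 2⟧ ∨ a ∈ box⟦r + 2 + hF, c, hG, 1⟧ ∨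
        a ∈ box⟦r + 2 + hF, c + m + 1, hG, 1⟧ ∨ a ∈ box⟦r + hF + hG + 1, c + 1, 1, m⟧ := by
    intro a ha
    rw [Finset.mem_sdiff] at ha
    obtain ⟨haB, haD⟩ := ha
    rw [mem_box] at haB
    have inFr : ∀ v : ℕ × ℕ, (v.1 = r ∧ v.2 = c) ∨ (v.1 = r ∧ v.2 = c + m + 1) ∨
        (v.1 = r ∧ v.2 = c + 1) ∨ (v.1 = r + 1 ∧ v.2 = c) ∨ (v.1 = r ∧ v.2 = c + m) ∨
        (v.1 = r + 1 ∧ v.2 = c + m + 1) →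
        v ∈ box⟦r + 1, c + 1, hF, m⟧ ∪ ((((box⟦r + 2, c, hF, 1⟧ ∪ box⟦r + 1 + hF, c + 1, hG, m⟧) ∪
          box⟦r + 2, c + m + 1, hF, 1⟧)) ∪
          {(r, c), (r, c + m + 1), (r, c + 1), (r + 1, c), (r, c + m), (r + 1, c + m + 1)}) := by
      intro v hv
      refine Finset.mem_union_right _ (Finset.mem_union_right _ ?_)
      simp only [Finset.mem_insert, Finset.mem_singleton, Prod.ext_iff]
      exact hv
    have inF : ∀ v : ℕ × ℕ, v ∈ box⟦r + 1, c + 1, hF, m⟧ → v ∈ box⟦r + 1, c + 1, hF, m⟧ ∪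
        ((((box⟦r + 2, c, hF, 1⟧ ∪ box⟦r + 1 + hF, c + 1, hG, m⟧) ∪ box⟦r + 2, c + m + 1, hF, 1⟧)) ∪
          {(r, c), (r, c + m + 1), (r, c + 1), (r + 1, c), (r, c + m), (r + 1, c + m + 1)}) :=
      fun v hv => Finset.mem_union_left _ hv
    have inL : ∀ v : ℕ × ℕ, v ∈ box⟦r + 2, c, hF, 1⟧ → v ∈ box⟦r + 1, c + 1, hF, m⟧ ∪
        ((((box⟦r + 2, c, hF, 1⟧ ∪ box⟦r + 1 + hF, c + 1, hG, m⟧) ∪ box⟦r + 2, c + m + 1, hF, 1⟧)) ∪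
          {(r, c), (r, c + m + 1), (r, c + 1), (r + 1, c), (r, c + m), (r + 1, c + m + 1)}) :=
      fun v hv => Finset.mem_union_right _ (Finset.mem_union_left _
        (Finset.mem_union_left _ (Finset.mem_union_left _ hv)))
    have inG : ∀ v : ℕ × ℕ, v ∈ box⟦r + 1 + hF, c + 1, hG, m⟧ → v ∈ box⟦r + 1, c + 1, hF, m⟧ ∪
        ((((box⟦r + 2, c, hF, 1⟧ ∪ box⟦r + 1 + hF, c + 1, hG, m⟧) ∪ box⟦r + 2, c + m + 1, hF, 1⟧)) ∪
          {(r, c), (r, c + m + 1), (r, c + 1), (r + 1, c), (r, c + m), (r + 1, c + m + 1)}) :=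
      fun v hv => Finset.mem_union_right _ (Finset.mem_union_left _
        (Finset.mem_union_left _ (Finset.mem_union_right _ hv)))
    have inR : ∀ v : ℕ × ℕ, v ∈ box⟦r + 2, c + m + 1, hF, 1⟧ → v ∈ box⟦r + 1, c + 1, hF, m⟧ ∪
        ((((box⟦r + 2, c, hF, 1⟧ ∪ box⟦r + 1 + hF, c + 1, hG, m⟧) ∪ box⟦r + 2, c + m + 1, hF, 1⟧)) ∪
          {(r, c), (r, c + m + 1), (r, c + 1), (r + 1, c), (r, c + m), (r + 1, c + m + 1)}) :=
      fun v hv => Finset.mem_union_right _ (Finset.mem_union_left _ (Finset.mem_union_right _ hv))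
    -- columns: left, inner, right
    rcases (show a.2 = c ∨ (c + 1 ≤ a.2 ∧ a.2 ≤ c + m) ∨ a.2 = c + m + 1 by omega) with h2 | h2 | h2
    · -- left column
      rcases (show a.1 = r ∨ a.1 = r + 1 ∨ (r + 2 ≤ a.1 ∧ a.1 ≤ r + 1 + hF) ∨ r + 2 + hF ≤ a.1 by omega)
        with h1 | h1 | h1 | h1
      · exact absurd (inFr a (by omega)) haD
      · exact absurd (inFr a (by omega)) haD
      · exact absurd (inL a (by rw [mem_box]; omega)) haD
      · exact Or.inr (Or.inl (by rw [mem_box]; omega))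
    · -- inner columns
      rcases (show a.1 = r ∨ (r + 1 ≤ a.1 ∧ a.1 ≤ r + hF) ∨ (r + 1 + hF ≤ a.1 ∧ a.1 ≤ r + hF + hG) ∨
          a.1 = r + hF + hG + 1 by omega) with h1 | h1 | h1 | h1
      · rcases (show a.2 = c + 1 ∨ (c + 2 ≤ a.2 ∧ a.2 + 1 ≤ c + m) ∨ a.2 = c + m by omega)
          with h3 | h3 | h3
        · exact absurd (inFr a (by omega)) haD
        · exact Or.inl (by rw [mem_box]; omega)
        · exact absurd (inFr a (by omega)) haD
      · exact absurd (inF a (by rw [mem_box]; omega)) haD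
      · exact absurd (inG a (by rw [mem_box]; omega)) haD
      · exact Or.inr (Or.inr (Or.inr (by rw [mem_box]; omega)))
    · -- right column
      rcases (show a.1 = r ∨ a.1 = r + 1 ∨ (r + 2 ≤ a.1 ∧ a.1 ≤ r + 1 + hF) ∨ r + 2 + hF ≤ a.1 by omega)
        with h1 | h1 | h1 | h1
      · exact absurd (inFr a (by omega)) haD
      · exact absurd (inFr a (by omega)) haD
      · exact absurd (inR a (by rw [mem_box]; omega)) haD
      · exact Or.inr (Or.inr (Or.inl (by rw [mem_box]; omega)))
  -- no non-zero dart starts or ends in the filler region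
  have hzero : ∀ a b, a ∈ box⟦r, c, hF + hG + 2, m + 2⟧ \ (box⟦r + 1, c + 1, hF, m⟧ ∪
      ((((box⟦r + 2, c, hF, 1⟧ ∪ box⟦r + 1 + hF, c + 1, hG, m⟧) ∪ box⟦r + 2, c + m + 1, hF, 1⟧)) ∪
        {(r, c), (r, c + m + 1), (r, c + 1), (r + 1, c), (r, c + m), (r + 1, c + m + 1)})) ∨
      b ∈ box⟦r, c, hF + hG + 2, m + 2⟧ \ (box⟦r + 1, c + 1, hF, m⟧ ∪
      ((((box⟦r + 2, c, hF, 1⟧ ∪ box⟦r + 1 + hF, c + 1, hG, m⟧) ∪ box⟦r + 2, c + m + 1, hF, 1⟧)) ∪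
        {(r, c), (r, c + m + 1), (r, c + 1), (r + 1, c), (r, c + m), (r + 1, c + m + 1)})) →
      W a b = 0 := by
    intro a b hab
    rcases hab with ha | hb
    · have hPa := hP a ha
      rw [mem_box, mem_box, mem_box, mem_box] at hPa
      rw [hW, zF a b (Or.inl (by rw [mem_box]; omega)), zG a b (Or.inl (by rw [mem_box]; omega)),
        zero_add, zero_add]
      by_contra hne
      have := hXS a b hne
      omega
    · have hPb := hP b hb
      rw [mem_box, mem_box, mem_box, mem_box] at hPb
      rw [hW, zF a b (Or.inr (by rw [mem_box]; omega)), zG a b (Or.inr (by rw [mem_box]; omega)),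
        zero_add, zero_add]
      by_contra hne
      have := hXS a b hne
      omega
  -- the domino tiling of the filler region
  have hτ : ∀ a ∈ box⟦r, c, hF + hG + 2, m + 2⟧ \ (box⟦r + 1, c + 1, hF, m⟧ ∪
      ((((box⟦r + 2, c, hF, 1⟧ ∪ box⟦r + 1 + hF, c + 1, hG, m⟧) ∪ box⟦r + 2, c + m + 1, hF, 1⟧)) ∪
        {(r, c), (r, c + m + 1), (r, c + 1), (r + 1, c), (r, c + m), (r + 1, c + m + 1)})),
      (parTau r c hF hG m) a ∈
          box⟦r, c, hF + hG + 2, m + 2⟧ \ (box⟦r + 1, c + 1, hF, m⟧ ∪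
          ((((box⟦r + 2, c, hF, 1⟧ ∪ box⟦r + 1 + hF, c + 1, hG, m⟧) ∪ box⟦r + 2, c + m + 1, hF, 1⟧)) ∪
            {(r, c), (r, c + m + 1), (r, c + 1), (r + 1, c), (r, c + m), (r + 1, c + m + 1)})) ∧
        (parTau r c hF hG m) a ≠ a ∧
        (parTau r c hF hG m)
          ((parTau r c hF hG m) a) = a ∧
        Adj⟦a, (parTau r c hF hG m) a⟧ := by
    intro a ha
    have hPa := hP a ha
    rw [mem_box, mem_box, mem_box, mem_box] at hPa
    simp only [parTau_apply]
    refine ⟨?_, ?_, ?_, ?_⟩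
    · split_ifs <;>
      · rw [Finset.mem_sdiff, mem_box]
        refine ⟨by dsimp only; omega, fun hmem => ?_⟩
        simp only [Finset.mem_union, mem_box, Finset.mem_insert, Finset.mem_singleton,
          Prod.ext_iff] at hmem
        omega
    · intro h
      split_ifs at h <;>
      · have h1 := congrArg Prod.fst h
        have h2 := congrArg Prod.snd h
        dsimp only at h1 h2
        omega
    · split_ifs <;>
        first
        | (exfalso; omega)
        | (ext <;> (dsimp only; omega))
        | (ext <;> omega)
    · split_ifs <;> (dsimp only; omega)
  exact ⟨hzero, hτ⟩

end ParFill

section ParGadget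

variable {R : Type*} [CommSemiring R] {ι : Type*}

/-- **Parallel composition in the grid.**  `F` (an `hF × m` grid gadget) sits at `(r+1, c+1)`, `G`
(an `hG × m` grid gadget) right below it at `(r+1+hF, c+1)`; the frame occupies row `r` and the
columns `c`, `c+m+1`: ports `p = (r, c)`, `q = (r, c+m+1)`, split vertices `pF = (r, c+1)`,
`qF = (r, c+m)` above the ports of `F`, `pG = (r+1, c)`, `qG = (r+1, c+m+1)` on top of two unit wires
running down the side columns to row `r+1+hF`, where they meet the ports of `G`; dart `p → pF`
carries the label `x`, dart `p → pG` the label `y`, every other frame/wire dart is unit; the rest of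
the `(hF+hG+2) × (m+2)` rectangle is tiled by unit dominoes (`parTau`).  A grid gadget for
`x * gF + y * gG` (`par_core` + `par_fillers` + `gad_fill'`; DKLM 2010 §4.4 / Valiant 1979 §2).
[folklore] -/
theorem gad_par {WF WG : ℕ × ℕ → ℕ × ℕ → MvPolynomial ι R} {r c hF hG m : ℕ}
    {gF gG x y : MvPolynomial ι R} (hGF : Gad⟦WF, r + 1, c + 1, hF, m, gF⟧)
    (hGG : Gad⟦WG, r + 1 + hF, c + 1, hG, m, gG⟧) (hx : IsLab⟦x⟧) (hy : IsLab⟦y⟧)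
    (ehF : Even hF) (ehG : Even hG) (em : Even m) (h2F : 2 ≤ hF) (h2G : 2 ≤ hG) (h2m : 2 ≤ m) :
    ∃ W : ℕ × ℕ → ℕ × ℕ → MvPolynomial ι R,
      Gad⟦W, r, c, hF + hG + 2, m + 2, x * gF + y * gG⟧ := by
  obtain ⟨hpar, hlab, hsuppB⟩ := par_core hGF hGG hx hy ehF ehG em h2F h2G h2m
  obtain ⟨hzero, hτ⟩ := par_fillers hGF hGG ehF ehG em h2F h2G h2m
  obtain ⟨W', hlab', hsupp', hT'⟩ := gad_fill' _ hlab hsuppB hzero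
    (twoState_of_eq hpar (show x * gF + y * (1 * gG * 1) = x * gF + y * gG by ring))
    (fun v hv => by
      simp only [Finset.mem_union, mem_box, Finset.mem_insert, Finset.mem_singleton,
        Prod.ext_iff] at hv
      rw [mem_box]
      omega) hτ
  refine ⟨W', hlab', hsupp', ?_⟩
  simpa only [show c + (m + 2) - 1 = c + m + 1 by omega] using hT'

end ParGadget

section HasGadget

variable {R : Type*} [CommSemiring R] {ι : Type*}

/-- `HasGad⟦ι, R, g, n⟧` (local notation): `g` has grid gadgets of even height and even width at most
`n` (and at least `2`) at every position of the grid. -/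
local notation3 "HasGad⟦" ι ", " R ", " g ", " n "⟧" => ∃ hh ww : ℕ, hh ≤ n ∧ ww ≤ n ∧ Even hh ∧ Even ww ∧
  2 ≤ hh ∧ 2 ≤ ww ∧ ∀ r c : ℕ, ∃ W : ℕ × ℕ → ℕ × ℕ → MvPolynomial ι R, Gad⟦W, r, c, hh, ww, g⟧

/-- Monotonicity of the size bound. [folklore] -/
theorem hasGad_mono {g : MvPolynomial ι R} {n n' : ℕ} (h : HasGad⟦ι, R, g, n⟧) (hn : n ≤ n') :
    HasGad⟦ι, R, g, n'⟧ := by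
  obtain ⟨hh, ww, h1, h2, rest⟩ := h
  exact ⟨hh, ww, h1.trans hn, h2.trans hn, rest⟩

/-- A label has the `2 × 2` leaf gadget. [folklore] -/
theorem hasGad_leaf {ℓ : MvPolynomial ι R} (hℓ : IsLab⟦ℓ⟧) : HasGad⟦ι, R, ℓ, 2⟧ :=
  ⟨2, 2, le_rfl, le_rfl, even_two, even_two, le_rfl, le_rfl, fun r c => gad_row hℓ r c 2 0 (by norm_num)⟩

/-- Products: series composition. [folklore] -/
theorem hasGad_mul {f g : MvPolynomial ι R} {n n' : ℕ} (hf : HasGad⟦ι, R, f, n⟧)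
    (hg : HasGad⟦ι, R, g, n'⟧) : HasGad⟦ι, R, f * g, n + n'⟧ := by
  obtain ⟨hF, wF, hhF, hwF, ehF, ewF, h2F, w2F, HF⟩ := hf
  obtain ⟨hG, wG, hhG, hwG, ehG, ewG, h2G, w2G, HG⟩ := hg
  refine ⟨max hF hG, wF + wG, by omega, by omega, ?_, ewF.add ewG, by omega, by omega, fun r c => ?_⟩
  · rcases le_total hF hG with h | h
    · rwa [max_eq_right h]
    · rwa [max_eq_left h]
  · obtain ⟨WF, hWF⟩ := HF r c
    obtain ⟨WG, hWG⟩ := HG r (c + wF)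
    exact gad_series hWF hWG ewF ewG w2F w2G (by omega) (by omega)

/-- Padding the width by a unit row gadget in series. [folklore] -/
theorem gad_padTo {g : MvPolynomial ι R} {hh ww M : ℕ}
    (H : ∀ r c : ℕ, ∃ W : ℕ × ℕ → ℕ × ℕ → MvPolynomial ι R, Gad⟦W, r, c, hh, ww, g⟧) (eww : Even ww)
    (eM : Even M) (hwM : ww ≤ M) (h2w : 2 ≤ ww) (h1h : 1 ≤ hh) :
    ∀ r c : ℕ, ∃ W : ℕ × ℕ → ℕ × ℕ → MvPolynomial ι R, Gad⟦W, r, c, hh, M, g⟧ := by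
  intro r c
  rcases Nat.eq_or_lt_of_le hwM with rfl | hlt
  · exact H r c
  · obtain ⟨a, ha⟩ := eww
    obtain ⟨b, hb⟩ := eM
    obtain ⟨k, hk⟩ : ∃ k, M = ww + (2 * k + 2) := ⟨b - a - 1, by omega⟩
    obtain ⟨WF, hWF⟩ := H r c
    obtain ⟨W1, hW1⟩ := gad_row (isLab_one (ι := ι) (R := R)) r (c + ww) hh k h1h
    obtain ⟨W, hW⟩ := gad_series hWF hW1 ⟨a, ha⟩ ⟨k + 1, by ring⟩ h2w (by omega) h1h h1h
    refine ⟨W, ?_⟩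
    simpa only [max_self, mul_one, hk] using hW

/-- Label combinations `x * f + y * g`: parallel composition after padding to a common width.
[folklore] -/
theorem hasGad_lin {f g x y : MvPolynomial ι R} {n n' : ℕ} (hx : IsLab⟦x⟧) (hy : IsLab⟦y⟧)
    (hf : HasGad⟦ι, R, f, n⟧) (hg : HasGad⟦ι, R, g, n'⟧) : HasGad⟦ι, R, x * f + y * g, n + n' + 2⟧ := by
  obtain ⟨hF, wF, hhF, hwF, ehF, ewF, h2F, w2F, HF⟩ := hf
  obtain ⟨hG, wG, hhG, hwG, ehG, ewG, h2G, w2G, HG⟩ := hg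
  have eM : Even (max wF wG) := by
    rcases le_total wF wG with h | h
    · rwa [max_eq_right h]
    · rwa [max_eq_left h]
  have HF' := gad_padTo HF ewF eM (le_max_left _ _) w2F (by omega)
  have HG' := gad_padTo HG ewG eM (le_max_right _ _) w2G (by omega)
  refine ⟨hF + hG + 2, max wF wG + 2, by omega, by omega, (ehF.add ehG).add even_two,
    eM.add even_two, by omega, by omega, fun r c => ?_⟩
  obtain ⟨WF, hWF⟩ := HF' (r + 1) (c + 1)
  obtain ⟨WG, hWG⟩ := HG' (r + 1 + hF) (c + 1)
  exact gad_par hWF hWG hx hy ehF ehG eM h2F h2G (by omega)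

/-- Scaling by a label: series composition with a leaf. [folklore] -/
theorem hasGad_smul {f x : MvPolynomial ι R} {n : ℕ} (hx : IsLab⟦x⟧) (hf : HasGad⟦ι, R, f, n⟧) :
    HasGad⟦ι, R, x * f, n + 2⟧ := by
  have h := hasGad_mul (hasGad_leaf hx) hf
  rwa [add_comm] at h

end HasGadget

end FormulaGridProjection

open Finset FormulaGridProjection in
/-- **Registered sub-goal `stub_formulaGridProjection_parallelGadget`** of `stub_formulaGridProjection`
(crux stmt-ValiantsHypothesis-5066, line `planar-dimer-sign-elimination`): PARALLEL COMPOSITION in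
the square grid — two grid gadgets of the same width stacked with a one-cell frame give a grid
gadget for `x * gF + y * gG` (`FormulaGridProjection.gad_par`, notation expanded). [folklore] -/
theorem stub_formulaGridProjection_parallelGadget : ∀ (R : Type) [CommSemiring R] (ι : Type) (WF WG : ℕ × ℕ → ℕ × ℕ → MvPolynomial ι R) (r c hF hG m : ℕ) (gF gG x y : MvPolynomial ι R), ((∀ a b, ((∃ j, WF a b = MvPolynomial.X j) ∨ ∃ c, WF a b = MvPolynomial.C c)) ∧ (∀ a b, WF a b ≠ 0 → a ∈ (Finset.Ico (r + 1) ((r + 1) + hF) ×ˢ Finset.Ico (c + 1) ((c + 1) + m)) ∧ b ∈ (Finset.Ico (r + 1) ((r + 1) + hF) ×ˢ Finset.Ico (c + 1) ((c + 1) + m)) ∧ ((a.1 + 1 = b.1 ∧ a.2 = b.2) ∨ (b.1 + 1 = a.1 ∧ a.2 = b.2) ∨ (a.1 = b.1 ∧ a.2 + 1 = b.2) ∨ (a.1 = b.1 ∧ b.2 + 1 = a.2))) ∧ (((r + 1), (c + 1)) ∈ (Finset.Ico (r + 1) ((r + 1) + hF) ×ˢ Finset.Ico (c + 1) ((c + 1)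 + m)) ∧ ((r + 1), (c + 1) + m - 1) ∈ (Finset.Ico (r + 1) ((r + 1) + hF) ×ˢ Finset.Ico (c + 1) ((c + 1) + m)) ∧ ((r + 1), (c + 1)) ≠ ((r + 1), (c + 1) + m - 1) ∧ Even (Finset.card (Finset.Ico (r + 1) ((r + 1) + hF) ×ˢ Finset.Ico (c + 1) ((c + 1) + m))) ∧ FormulaGridProjection.msum (Finset.Ico (r + 1) ((r + 1) + hF) ×ˢ Finset.Ico (c + 1) ((c + 1) + m)) WF = gF ∧ FormulaGridProjection.msum (Finset.erase (Finset.erase (Finset.Ico (r + 1) ((r + 1) + hF) ×ˢ Finset.Ico (c + 1) ((c + 1) + m)) ((r + 1), (c + 1))) ((r + 1), (c + 1) + m - 1)) WF = 1)) → ((∀ a b, ((∃ j, WG a b = MvPolynomial.X j) ∨ ∃ c, WG a b = MvPolynomial.C c)) ∧ (∀ a b, WG a b ≠ 0 → a ∈ (Finset.Ico (r + 1 + hF) ((r + 1 + hF) + hG) ×ˢ Finset.Ico (c + 1) ((c + 1) + m)) ∧ b ∈ (Finset.Ico (r + 1 + hF) ((r + 1 + hF) + hG) ×ˢ Finset.Ico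 (c + 1) ((c + 1) + m)) ∧ ((a.1 + 1 = b.1 ∧ a.2 = b.2) ∨ (b.1 + 1 = a.1 ∧ a.2 = b.2) ∨ (a.1 = b.1 ∧ a.2 + 1 = b.2) ∨ (a.1 = b.1 ∧ b.2 + 1 = a.2))) ∧ (((r + 1 + hF), (c + 1)) ∈ (Finset.Ico (r + 1 + hF) ((r + 1 + hF) + hG) ×ˢ Finset.Ico (c + 1) ((c + 1) + m)) ∧ ((r + 1 + hF), (c + 1) + m - 1) ∈ (Finset.Ico (r + 1 + hF) ((r + 1 + hF) + hG) ×ˢ Finset.Ico (c + 1) ((c + 1) + m)) ∧ ((r + 1 + hF), (c + 1)) ≠ ((r + 1 + hF), (c + 1) + m - 1) ∧ Even (Finset.card (Finset.Ico (r + 1 + hF) ((r + 1 + hF) + hG) ×ˢ Finset.Ico (c + 1) ((c + 1) + m))) ∧ FormulaGridProjection.msum (Finset.Ico (r + 1 + hF) ((r + 1 + hF) + hG) ×ˢ Finset.Ico (c + 1) ((c + 1) + m)) WG = gG ∧ FormulaGridProjection.msum (Finset.erase (Finset.erase (Finset.Ico (r + 1 + hF) ((r + 1 + hF) + hG) ×ˢ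 Finset.Ico (c + 1) ((c + 1) + m)) ((r + 1 + hF), (c + 1))) ((r + 1 + hF), (c + 1) + m - 1)) WG = 1)) → ((∃ j, x = MvPolynomial.X j) ∨ ∃ c, x = MvPolynomial.C c) → ((∃ j, y = MvPolynomial.X j) ∨ ∃ c, y = MvPolynomial.C c) → Even hF → Even hG → Even m → 2 ≤ hF → 2 ≤ hG → 2 ≤ m → ∃ W : ℕ × ℕ → ℕ × ℕ → MvPolynomial ι R, ((∀ a b, ((∃ j, W a b = MvPolynomial.X j) ∨ ∃ c, W a b = MvPolynomial.C c)) ∧ (∀ a b, W a b ≠ 0 → a ∈ (Finset.Ico r (r + (hF + hG + 2)) ×ˢ Finset.Ico c (c + (m + 2))) ∧ b ∈ (Finset.Ico r (r + (hF + hG + 2)) ×ˢ Finset.Ico c (c + (m + 2))) ∧ ((a.1 + 1 = b.1 ∧ a.2 = b.2) ∨ (b.1 + 1 = a.1 ∧ a.2 = b.2) ∨ (a.1 = b.1 ∧ a.2 + 1 = b.2) ∨ (a.1 = b.1 ∧ b.2 + 1 = a.2))) ∧ ((r, c) ∈ (Finset.Ico r (r + (hF + hG + 2)) ×ˢ Finset.Ico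 c (c + (m + 2))) ∧ (r, c + (m + 2) - 1) ∈ (Finset.Ico r (r + (hF + hG + 2)) ×ˢ Finset.Ico c (c + (m + 2))) ∧ (r, c) ≠ (r, c + (m + 2) - 1) ∧ Even (Finset.card (Finset.Ico r (r + (hF + hG + 2)) ×ˢ Finset.Ico c (c + (m + 2)))) ∧ FormulaGridProjection.msum (Finset.Ico r (r + (hF + hG + 2)) ×ˢ Finset.Ico c (c + (m + 2))) W = (x * gF + y * gG) ∧ FormulaGridProjection.msum (Finset.erase (Finset.erase (Finset.Ico r (r + (hF + hG + 2)) ×ˢ Finset.Ico c (c + (m + 2))) (r, c)) (r, c + (m + 2) - 1)) W = 1)) :=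
  fun _ _ _ _ _ _ _ _ _ _ _ _ _ _ hF hG hx hy ehF ehG em h2F h2G h2m =>
    gad_par hF hG hx hy ehF ehG em h2F h2G h2m

end Summit.ValiantsHypothesis.ValiantsHypothesis.Theorems.DivisionGapZeroOneTransfer
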